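import Mathlib.Data.ZMod.Basic
import Mathlib.Algebra.Field.ZMod
import Literature.Computability.MetaComplexity.NWTables
import HarnessLib

/-!
# The design of lines: an explicit weak design with closed-form blocks

Topic `Literature/Computability/MetaComplexity`, sequel of `NWTables.lean`. Hirahara's reconstruction
(FOCS 2018 / ECCC TR18-138, §4.1) needs designs of WEAK-design quality (Def. 4.3: what is paid is the
table size `∑_{j<i} 2^{|Sᵢ ∩ Sⱼ|}`, which must be `(1 + o(1))·i`), obtained in Lemma 4.4 from the
randomised construction of Raz–Reingold–Vadhan derandomised by conditional expectations
(`WeakDesigns.lean`). For the string machines of the reduction a design whose blocks are given by a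
closed formula is far cheaper, and the oldest design of all has the required quality in the regime
`m ≤ q²`: the Nisan–Wigderson polynomial design (JCSS 1994, Lemma 2.5) of DEGREE ONE — the graphs of
the lines `t ↦ α t + β` over a prime field `𝔽_q`, restricted to the first `ℓ ≤ q` abscissae, block
`j < q²` being the line with `(α, β) = (j / q, j mod q)`:

* `LineDesign.lineVal q j t = ((j / q)·t + j mod q) mod q`, `LineDesign.lineWord` (the word of block
  `j`, a `List ℕ`), `LineDesign.lineWordT` (typed, `[ℓ] → [q]`), `wordList_lineWordT`;
* `agree_eq_zero_of_div_eq` — parallel distinct lines never meet; `agree_le_one` — lines of distinct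
  slopes meet at most once (`q` prime, `ℓ ≤ q`); `sum_pow_agree_slope_le` — against all `q` lines of a
  fixed other slope the table size is `≤ q + ℓ` (each abscissa is hit by exactly one of them);
* **`LineDesign.sum_pow_agree_lt_le`** — the weak-design quality in closed form:
  `∑_{j<i} 2^{agree wᵢ wⱼ} ≤ i + (i / q)·ℓ ≤ (1 + ℓ/q)·i` for `i < q²` — the same first-order quality
  `(1 + ℓ/d·ℓ)·i = (1 + ℓ/q)·i` as Lemma 4.4's `(1 + ℓ/d)^ℓ·i`, `d = ℓ q`;
* **`LineDesign.length_tables_le`** — hence the concatenated advice tables (`NWStr.tables`) of block `i`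
  of the NW generator on this design have length `≤ i + (i / q)·ℓ`.

## References

* N. Nisan, A. Wigderson, *Hardness vs randomness*, JCSS 49 (1994) 149–167, Lemma 2.5 (the
  polynomial design).
* R. Raz, O. Reingold, S. Vadhan, JCSS 65 (2002) 97–128, Def. 6 (weak designs), Lemma 15.
* S. Hirahara, ECCC TR18-138 (2018), Def. 4.3, Lemma 4.4, proof of Lemma 4.6 and of Cor. 4.12.
-/

namespace Literature.Computability.MetaComplexity

open Finset

namespace LineDesign

/-! ### The blocks -/

/-- The value at abscissa `t` of the line of block `j`: `(α t + β) mod q` with `α = j / q`,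
`β = j mod q`. [cite: NisanWigderson1994, Lemma 2.5 (polynomial design, degree 1)] -/
def lineVal (q j t : ℕ) : ℕ := (j / q * t + j % q) % q

/-- Values are symbols `< q`. [folklore] -/
theorem lineVal_lt {q : ℕ} (hq : 0 < q) (j t : ℕ) : lineVal q j t < q := Nat.mod_lt _ hq

/-- The word of block `j` (its values at the abscissae `0, …, ℓ-1`). [cite: NisanWigderson1994, Lemma 2.5] -/
def lineWord (q ℓ j : ℕ) : List ℕ := (List.range ℓ).map (lineVal q j)

/-- Length of a word. [folklore] -/
@[simp] theorem length_lineWord (q ℓ j : ℕ) : (lineWord q ℓ j).length = ℓ := by simp [lineWord]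

/-- Entries of a word. [folklore] -/
@[simp] theorem getElem_lineWord (q ℓ j : ℕ) {t : ℕ} (ht : t < (lineWord q ℓ j).length) :
    (lineWord q ℓ j)[t] = lineVal q j t := by
  simp [lineWord]

/-- Symbols of a word are `< q`. [folklore] -/
theorem lt_of_mem_lineWord {q : ℕ} (hq : 0 < q) {ℓ j v : ℕ} (hv : v ∈ lineWord q ℓ j) : v < q := by
  simp only [lineWord, List.mem_map, List.mem_range] at hv
  obtain ⟨t, -, rfl⟩ := hv
  exact lineVal_lt hq j t

/-- The typed word of block `j`. [cite: NisanWigderson1994, Lemma 2.5] -/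
def lineWordT {q : ℕ} (hq : 0 < q) (ℓ j : ℕ) : Fin ℓ → Fin q := fun t => ⟨lineVal q j t, lineVal_lt hq j t⟩

/-- The typed word lists to the word. [folklore] -/
@[simp] theorem wordList_lineWordT {q : ℕ} (hq : 0 < q) (ℓ j : ℕ) : NWStr.wordList (lineWordT hq ℓ j) = lineWord q ℓ j := by
  apply List.ext_getElem
  · simp
  · intro t h1 h2
    simp [lineWordT]

/-! ### Agreements of lines -/

/-- The value in `ZMod q`. [folklore] -/
theorem cast_lineVal (q j t : ℕ) : ((lineVal q j t : ℕ) : ZMod q) = (j / q : ℕ) * (t : ℕ) + (j % q : ℕ) := by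
  rw [lineVal, ZMod.natCast_mod]; push_cast; ring

/-- Equal values iff equal in `ZMod q` (values are `< q`). [folklore] -/
theorem lineVal_eq_iff {q : ℕ} (hq : 0 < q) (i j t : ℕ) :
    lineVal q i t = lineVal q j t ↔ ((i / q : ℕ) : ZMod q) * (t : ℕ) + (i % q : ℕ) = (j / q : ℕ) * (t : ℕ) + (j % q : ℕ) := by
  haveI : NeZero q := ⟨hq.ne'⟩
  rw [← cast_lineVal, ← cast_lineVal]
  constructor
  · intro h; rw [h]
  · intro h
    have := congrArg ZMod.val h
    rwa [ZMod.val_natCast, ZMod.val_natCast, Nat.mod_eq_of_lt (lineVal_lt hq i t), Nat.mod_eq_of_lt (lineVal_lt hq j t)] at this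

/-- **Parallel distinct lines never meet**: blocks of the same slope `i / q = j / q`, `i ≠ j`, agree
nowhere. [cite: NisanWigderson1994, Lemma 2.5 (proof)] -/
theorem agree_eq_zero_of_div_eq {q : ℕ} (hq : 0 < q) (ℓ : ℕ) {i j : ℕ} (hdiv : i / q = j / q) (hne : i ≠ j) :
    agree (lineWordT hq ℓ i) (lineWordT hq ℓ j) = 0 := by
  haveI : NeZero q := ⟨hq.ne'⟩
  rw [agree, Finset.card_eq_zero, Finset.filter_eq_empty_iff]
  intro t _ h
  have h' : lineVal q i t = lineVal q j t := congrArg Fin.val h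
  rw [lineVal_eq_iff hq, hdiv, add_right_inj] at h'
  have hmod : i % q = j % q := by
    have := congrArg ZMod.val h'
    rwa [ZMod.val_natCast, ZMod.val_natCast, Nat.mod_eq_of_lt (Nat.mod_lt i hq), Nat.mod_eq_of_lt (Nat.mod_lt j hq)] at this
  exact hne (by rw [← Nat.div_add_mod i q, ← Nat.div_add_mod j q, hdiv, hmod])

/-- **Lines of distinct slopes meet at most once** (`q` prime, abscissae `< ℓ ≤ q` are distinct residues).
[cite: NisanWigderson1994, Lemma 2.5 (proof: two polynomials of degree `≤ d` agree on `≤ d` points)] -/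
theorem agree_le_one {q : ℕ} (hp : q.Prime) {ℓ : ℕ} (hℓ : ℓ ≤ q) {i j : ℕ} (hi : i / q < q) (hj : j / q < q) (hdiv : i / q ≠ j / q) :
    agree (lineWordT hp.pos ℓ i) (lineWordT hp.pos ℓ j) ≤ 1 := by
  haveI : Fact q.Prime := ⟨hp⟩
  rw [agree, Finset.card_le_one]
  intro t ht t' ht'
  simp only [mem_filter, mem_univ, true_and] at ht ht'
  have h1 : lineVal q i t = lineVal q j t := congrArg Fin.val ht
  have h2 : lineVal q i t' = lineVal q j t' := congrArg Fin.val ht'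
  rw [lineVal_eq_iff hp.pos] at h1 h2
  -- subtract: `(αᵢ - αⱼ)(t - t') = 0` in the field `ZMod q`
  have h3 : (((i / q : ℕ) : ZMod q) - (j / q : ℕ)) * ((t : ℕ) - (t' : ℕ) : ZMod q) = 0 := by
    linear_combination h1 - h2
  rcases mul_eq_zero.1 h3 with h | h
  · exfalso
    apply hdiv
    have := congrArg ZMod.val (sub_eq_zero.1 h)
    rwa [ZMod.val_natCast, ZMod.val_natCast, Nat.mod_eq_of_lt hi, Nat.mod_eq_of_lt hj] at this
  · have := congrArg ZMod.val (sub_eq_zero.1 h)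
    rw [ZMod.val_natCast, ZMod.val_natCast, Nat.mod_eq_of_lt (t.isLt.trans_le hℓ), Nat.mod_eq_of_lt (t'.isLt.trans_le hℓ)] at this
    exact Fin.ext this

/-- For a fixed abscissa and slope, at most one intercept `β < q` makes the line hit a given value:
`(α t + β) mod q` is injective in `β < q`. [folklore] -/
theorem card_filter_intercept_le_one (q α t v : ℕ) :
    #{β ∈ range q | (α * t + β) % q = v} ≤ 1 := by
  rw [Finset.card_le_one]
  intro β hβ β' hβ'
  simp only [mem_filter, mem_range] at hβ hβ'
  have h : (α * t + β) % q = (α * t + β') % q := by rw [hβ.2, hβ'.2]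
  have := Nat.ModEq.add_left_cancel' (α * t) h
  rwa [Nat.ModEq, Nat.mod_eq_of_lt hβ.1, Nat.mod_eq_of_lt hβ'.1] at this

/-- **Against all lines of one other slope the table size is `≤ q + ℓ`**: for `α ≠ i / q` (both `< q`),
`∑_{β<q} 2^{agree wᵢ w_{αq+β}} ≤ q + ℓ` — each of the `q` lines meets `wᵢ` at most once, and each
abscissa is met by at most one of them. [cite: Hirahara2018, Def. 4.3 (quality)] [cite: NisanWigderson1994, Lemma 2.5] -/
theorem sum_pow_agree_slope_le {q : ℕ} (hp : q.Prime) {ℓ : ℕ} (hℓ : ℓ ≤ q) {i α : ℕ} (hi : i / q < q) (hα : α < q)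
    (hne : i / q ≠ α) :
    ∑ β ∈ range q, 2 ^ agree (lineWordT hp.pos ℓ i) (lineWordT hp.pos ℓ (α * q + β)) ≤ q + ℓ := by
  have hq := hp.pos
  have hdivβ : ∀ β < q, (α * q + β) / q = α := fun β hβ => by
    rw [Nat.add_comm, Nat.add_mul_div_right _ _ hq, Nat.div_eq_of_lt hβ, Nat.zero_add]
  have hmodβ : ∀ β < q, (α * q + β) % q = β := fun β hβ => by
    rw [Nat.add_comm, Nat.add_mul_mod_self_right, Nat.mod_eq_of_lt hβ]
  -- `2^{agree} ≤ 1 + agree` since `agree ≤ 1`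
  have h1 : ∀ β ∈ range q, 2 ^ agree (lineWordT hp.pos ℓ i) (lineWordT hp.pos ℓ (α * q + β)) ≤
      1 + agree (lineWordT hp.pos ℓ i) (lineWordT hp.pos ℓ (α * q + β)) := by
    intro β hβ
    rw [mem_range] at hβ
    have ha := agree_le_one hp hℓ hi (by rw [hdivβ β hβ]; exact hα) (by rw [hdivβ β hβ]; exact hne)
    interval_cases agree (lineWordT hp.pos ℓ i) (lineWordT hp.pos ℓ (α * q + β)) <;> simp
  refine (sum_le_sum h1).trans ?_
  rw [sum_add_distrib, sum_const, card_range, smul_eq_mul, mul_one, Nat.add_le_add_iff_left]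
  -- double counting: `∑_β agree = ∑_t #{β | match at t} ≤ ∑_t 1 = ℓ`
  have h2 : ∀ β ∈ range q, agree (lineWordT hp.pos ℓ i) (lineWordT hp.pos ℓ (α * q + β)) =
      ∑ t : Fin ℓ, if (i / q * t + i % q) % q = (α * t + β) % q then 1 else 0 := by
    intro β hβ
    rw [mem_range] at hβ
    rw [agree, Finset.card_filter]
    refine sum_congr rfl fun t _ => ?_
    have : (lineWordT hp.pos ℓ i t = lineWordT hp.pos ℓ (α * q + β) t) ↔ (i / q * t + i % q) % q = (α * t + β) % q := by
      rw [Fin.ext_iff]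
      simp only [lineWordT, lineVal, hdivβ β hβ, hmodβ β hβ]
    simp only [this]
  rw [sum_congr rfl h2, sum_comm]
  calc ∑ t : Fin ℓ, ∑ β ∈ range q, (if (i / q * ↑t + i % q) % q = (α * ↑t + β) % q then 1 else 0)
      = ∑ t : Fin ℓ, #{β ∈ range q | (α * t + β) % q = (i / q * t + i % q) % q} := by
        refine sum_congr rfl fun t _ => ?_
        rw [Finset.card_filter]
        refine sum_congr rfl fun β _ => ?_
        simp only [eq_comm]
    _ ≤ ∑ _t : Fin ℓ, 1 := sum_le_sum fun t _ => card_filter_intercept_le_one q α t _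
    _ = ℓ := by simp

/-- Summing over `range (A q)` by slope and intercept. [folklore] -/
theorem sum_range_mul_eq {M : Type*} [AddCommMonoid M] (f : ℕ → M) (q : ℕ) : ∀ A : ℕ,
    ∑ j ∈ range (A * q), f j = ∑ α ∈ range A, ∑ β ∈ range q, f (α * q + β)
  | 0 => by simp
  | A + 1 => by
    rw [sum_range_succ, ← sum_range_mul_eq f q A, Nat.succ_mul, sum_range_add]

/-- **The weak-design quality of the design of lines, in closed form** (`q` prime, `ℓ ≤ q`, `i < q²`):
`∑_{j<i} 2^{agree wᵢ wⱼ} ≤ i + (i / q)·ℓ`. The first `(i/q)·q` blocks are the full slope classes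
`α < i / q` (each contributing `≤ q + ℓ`), the remaining `i mod q` blocks are parallel to block `i`
(each contributing `2⁰ = 1`). This is the quality `(1 + ℓ/q)·i` — to first order the `(1 + ℓ/d)^ℓ·i`,
`d = ℓ q`, of Hirahara's Lemma 4.4. [cite: Hirahara2018, Lemma 4.4] [cite: NisanWigderson1994, Lemma 2.5]
[cite: RazReingoldVadhan2002, Def. 6] -/
theorem sum_pow_agree_lt_le {q : ℕ} (hp : q.Prime) {ℓ : ℕ} (hℓ : ℓ ≤ q) {i : ℕ} (hi : i < q * q) :
    ∑ j ∈ range i, 2 ^ agree (lineWordT hp.pos ℓ i) (lineWordT hp.pos ℓ j) ≤ i + i / q * ℓ := by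
  have hq := hp.pos
  have hiq : i / q < q := Nat.div_lt_of_lt_mul hi
  set A := i / q with hA
  have hAq : A * q ≤ i := hA ▸ Nat.div_mul_le_self i q
  have hsplit : range i = range (A * q) ∪ Ico (A * q) i := by
    rw [range_eq_Ico, range_eq_Ico]
    exact (Ico_union_Ico_eq_Ico (Nat.zero_le _) hAq).symm
  have hdisj : Disjoint (range (A * q)) (Ico (A * q) i) := by
    rw [range_eq_Ico]; exact Ico_disjoint_Ico_consecutive _ _ _
  rw [hsplit, sum_union hdisj, sum_range_mul_eq]
  -- slope classes `α < A`
  have hpart1 : ∑ α ∈ range A, ∑ β ∈ range q, 2 ^ agree (lineWordT hp.pos ℓ i) (lineWordT hp.pos ℓ (α * q + β)) ≤ A * (q + ℓ) := by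
    calc _ ≤ ∑ _α ∈ range A, (q + ℓ) := sum_le_sum fun α hα => by
            rw [mem_range] at hα
            exact sum_pow_agree_slope_le hp hℓ hiq (hα.trans hiq) (Nat.ne_of_gt hα)
      _ = A * (q + ℓ) := by rw [sum_const, card_range, smul_eq_mul]
  -- parallel blocks `A q ≤ j < i`
  have hpart2 : ∑ j ∈ Ico (A * q) i, 2 ^ agree (lineWordT hp.pos ℓ i) (lineWordT hp.pos ℓ j) = i - A * q := by
    calc _ = ∑ _j ∈ Ico (A * q) i, 1 := sum_congr rfl fun j hj => by
            rw [mem_Ico] at hj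
            have hjq : j / q = A :=
              Nat.div_eq_of_lt_le hj.1 (hj.2.trans (by rw [Nat.mul_comm, hA]; exact Nat.lt_mul_div_succ i hq))
            rw [agree_eq_zero_of_div_eq hq ℓ (hA ▸ hjq.symm) (Nat.ne_of_gt hj.2), pow_zero]
      _ = i - A * q := by rw [sum_const, Nat.card_Ico, smul_eq_mul, mul_one]
  rw [hpart2]
  calc _ ≤ A * (q + ℓ) + (i - A * q) := Nat.add_le_add_right hpart1 _
    _ = i + A * ℓ := by rw [Nat.mul_add]; omega

/-! ### The advice tables of the NW generator on the design of lines -/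

/-- The design of lines as a listed design of `m` words. [cite: NisanWigderson1994, Lemma 2.5] -/
def lineDesign (q ℓ m : ℕ) : List (List ℕ) := (List.range m).map (lineWord q ℓ)

/-- `lineDesign` is the listing of the typed words. [folklore] -/
theorem lineDesign_eq_ofFn {q : ℕ} (hq : 0 < q) (ℓ m : ℕ) :
    lineDesign q ℓ m = List.ofFn fun j : Fin m => NWStr.wordList (lineWordT hq ℓ j) := by
  apply List.ext_getElem
  · simp [lineDesign]
  · intro j h1 h2
    simp [lineDesign]

/-- Length of the design. [folklore] -/
@[simp] theorem length_lineDesign (q ℓ m : ℕ) : (lineDesign q ℓ m).length = m := by simp [lineDesign]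

/-- Words of the design. [folklore] -/
theorem getD_lineDesign (q ℓ m : ℕ) {j : ℕ} (hj : j < m) : (lineDesign q ℓ m).getD j [] = lineWord q ℓ j := by
  rw [List.getD_eq_getElem _ _ (by simpa using hj)]
  simp [lineDesign]

/-- The design of lines is well formed (`NWStr.WF`). [folklore] -/
theorem wf_lineDesign {q : ℕ} (hq : 0 < q) (ℓ m : ℕ) : NWStr.WF ℓ q (lineDesign q ℓ m) := by
  rw [lineDesign_eq_ofFn hq]; exact NWStr.wf_ofFn_wordList _

/-- **Length of the concatenated advice tables on the design of lines**: for block `i < m ≤ q²`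
(`q` prime, `ℓ ≤ q`) the tables `NWStr.tables` have total length `≤ i + (i / q)·ℓ`.
[cite: Hirahara2018, Lemma 4.6 (proof, `∑_{j<i} 2^{|Sᵢ∩Sⱼ|}` bits)] [cite: Hirahara2018, Lemma 4.4] -/
theorem length_tables_le {q : ℕ} (hp : q.Prime) {ℓ m : ℕ} (hℓ : ℓ ≤ q) (hm : m ≤ q * q) {i : ℕ} (hi : i < m) (f z : List Bool) :
    (NWStr.tables q f (lineDesign q ℓ m) i z).length ≤ i + i / q * ℓ := by
  have hq := hp.pos
  rw [NWStr.length_tables, NWStr.offsetOf, getD_lineDesign q ℓ m hi, ← wordList_lineWordT hq]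
  have htake : (lineDesign q ℓ m).take i = (List.range i).map fun j => NWStr.wordList (lineWordT hq ℓ j) := by
    rw [lineDesign, ← List.map_take, List.take_range, min_eq_left hi.le]
    exact List.map_congr_left fun j _ => (wordList_lineWordT hq ℓ j).symm
  rw [htake, List.map_map]
  have hsum : ((List.range i).map ((fun gj => 2 ^ (NWStr.keyPos (NWStr.wordList (lineWordT hq ℓ i)) gj).length) ∘
      fun j => NWStr.wordList (lineWordT hq ℓ j))).sum = ∑ j ∈ range i, 2 ^ agree (lineWordT hq ℓ i) (lineWordT hq ℓ j) := by
    rw [← List.sum_toFinset _ (List.nodup_range), List.toFinset_range]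
    refine sum_congr rfl fun j _ => ?_
    simp only [Function.comp_apply, NWStr.length_keyPos_wordList]
  rw [hsum]
  exact sum_pow_agree_lt_le hp hℓ (hi.trans_le hm)

end LineDesign

end Literature.Computability.MetaComplexity
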